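import Mathlib
import HarnessLib
import Literature.MathematicalPhysics.StatisticalMechanics.WeightTowerStrong
import Literature.MathematicalPhysics.StatisticalMechanics.PolymerExpansion

/-!
# The strong weight over the blocks of a polymer: `∏_{B ∈ 𝓑_k(Z)} W_k^B = W_k^Z` and the (w5)
# inequality `w_k^Y · ∏_{B ∈ 𝓑_k(X∖Y)} W_k^B ≤ w_k^X` ([ABKM19] Theorem 7.1 (w5), Lemma 7.6 (ii))

For a strong form family `G_k^X` additive over DISJOINT sets (the tree's
`WeightData.StrongDominated G (fun _ X Y => Disjoint X Y)`, as for the [ABKM19] torus tower,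
`AbkmWeightBounds.strong`), the strong weight `W_k^X = expWeight (G k X)` is multiplicative over the blocks
of a polymer, and with Lemma 7.6 (ii) (`WeightData.weight_mul_strongWeight_le`) one gets the weight
inequality consumed by the `P₂` estimate (`PolymerProductBound.tayNormLE_sum_bprod_mul`):

* `strong_empty`, `strong_biUnion`, `expWeight_finset_sum`, **`prod_expWeight_blocks`**;
* **`weight_mul_prod_strongWeight_le`** — `(∏_{B ∈ 𝓑_k(X∖Y)} W_k^B(φ)) · w_k^Y(φ) ≤ w_k^X(φ)` for
  polymers `Y ⊆ X`.

Everything is proved; no named fact.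

## References
* S. Adams, S. Buchholz, R. Kotecký, S. Müller, arXiv:1910.13564, Theorem 7.1 (w5), Lemma 7.6 (ii),
  Lemma 8.3 (ii) [AdamsBuchholzKoteckyMuller2019].
-/

noncomputable section

namespace Literature.MathematicalPhysics.StatisticalMechanics.GradientRG

open scoped BigOperators Classical
open Finset Matrix
open Literature.MathematicalPhysics.StatisticalMechanics.TorusPolymer (IsPolymer blocks)

variable {Λ : Type*} [Fintype Λ] [DecidableEq Λ]

namespace WeightData

variable {W : WeightData Λ} {G : ℕ → Finset Λ → Matrix Λ Λ ℝ}

/-- `G_k^∅ = 0` for a strong family additive over disjoint sets. [cite: AdamsBuchholzKoteckyMuller2019, Theorem 7.1 (w5)] -/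
theorem strong_empty (hG : W.StrongDominated G fun _ X Y => Disjoint X Y) (k : ℕ) : G k ∅ = 0 := by
  have h := hG.strong_add k ∅ ∅ (disjoint_empty_left _)
  rw [Finset.empty_union] at h
  have : G k ∅ + G k ∅ = G k ∅ + 0 := by rw [add_zero]; exact h.symm
  exact add_left_cancel this

/-- Additivity over a pairwise disjoint finite family: `G_k^{⋃𝓢} = Σ_{B∈𝓢} G_k^B`.
[cite: AdamsBuchholzKoteckyMuller2019, Theorem 7.1 (w5)] -/
theorem strong_biUnion (hG : W.StrongDominated G fun _ X Y => Disjoint X Y) (k : ℕ)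
    (𝓢 : Finset (Finset Λ)) (hdisj : (𝓢 : Set (Finset Λ)).PairwiseDisjoint id) :
    G k (𝓢.biUnion id) = ∑ B ∈ 𝓢, G k B := by
  induction 𝓢 using Finset.induction_on with
  | empty => simp [strong_empty hG k]
  | insert B 𝓢 hB ih =>
    have hdisj' : (𝓢 : Set (Finset Λ)).PairwiseDisjoint id := hdisj.subset (by simp)
    have hd : Disjoint B (𝓢.biUnion id) := by
      rw [Finset.disjoint_biUnion_right]
      intro B' hB'
      have hne : B ≠ B' := fun h => hB (h ▸ hB')
      exact hdisj (mem_coe.2 (mem_insert_self _ _)) (mem_coe.2 (mem_insert_of_mem hB')) hne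
    rw [biUnion_insert, sum_insert hB, ← ih hdisj']
    exact hG.strong_add k B _ hd

end WeightData

omit [DecidableEq Λ] in
/-- `expWeight (Σ_i A_i) = ∏_i expWeight A_i`. [cite: AdamsBuchholzKoteckyMuller2019, Ch. 7.1 (7.4)] -/
theorem expWeight_finset_sum {ι : Type*} (𝓢 : Finset ι) (A : ι → Matrix Λ Λ ℝ) (φ : Λ → ℝ) :
    expWeight (∑ i ∈ 𝓢, A i) φ = ∏ i ∈ 𝓢, expWeight (A i) φ := by
  classical
  induction 𝓢 using Finset.induction_on with
  | empty => simp [expWeight]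
  | insert i 𝓢 hi ih => rw [sum_insert hi, prod_insert hi, expWeight_add, ih]

variable {d M : ℕ} [NeZero M]

/-- **`∏_{B ∈ 𝓑_k(Z)} W_k^B = W_k^Z`** for an `s`-polymer `Z` and a strong family additive over disjoint
sets. [cite: AdamsBuchholzKoteckyMuller2019, Lemma 8.3 (ii)] -/
theorem prod_expWeight_blocks {W : WeightData (Fin d → ZMod M)}
    {G : ℕ → Finset (Fin d → ZMod M) → Matrix (Fin d → ZMod M) (Fin d → ZMod M) ℝ}
    (hG : W.StrongDominated G fun _ X Y => Disjoint X Y) (k s : ℕ) {Z : Finset (Fin d → ZMod M)}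
    (hZ : IsPolymer s Z) (φ : (Fin d → ZMod M) → ℝ) :
    ∏ B ∈ blocks s Z, expWeight (G k B) φ = expWeight (G k Z) φ := by
  rw [← expWeight_finset_sum, ← WeightData.strong_biUnion hG k (blocks s Z)
    (TorusPolymer.pairwiseDisjoint_blocks s Z), hZ.biUnion_blocks]

/-- **(w5) in the form used by the `P₂` estimate**: for `s`-polymers `Y ⊆ X`,
`(∏_{B ∈ 𝓑_k(X∖Y)} W_k^B(φ)) · w_k^Y(φ) ≤ w_k^X(φ)` (Lemma 7.6 (ii): `A_k^Y + G_k^{X∖Y} ⪯ A_k^X`).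
[cite: AdamsBuchholzKoteckyMuller2019, Theorem 7.1 (w5)] -/
theorem weight_mul_prod_strongWeight_le {W : WeightData (Fin d → ZMod M)}
    {D : ℕ → Matrix (Fin d → ZMod M) (Fin d → ZMod M) ℝ} (hD : W.Dominated D) (hm : W.Monotone)
    {G : ℕ → Finset (Fin d → ZMod M) → Matrix (Fin d → ZMod M) (Fin d → ZMod M) ℝ}
    (hG : W.StrongDominated G fun _ X Y => Disjoint X Y) (k s : ℕ) {X Y : Finset (Fin d → ZMod M)}
    (hX : IsPolymer s X) (hY : IsPolymer s Y) (hYX : Y ⊆ X) (φ : (Fin d → ZMod M) → ℝ) :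
    (∏ B ∈ blocks s (X \ Y), expWeight (G k B) φ) * W.weight k Y φ ≤ W.weight k X φ := by
  rw [prod_expWeight_blocks hG k s (hX.sdiff hY) φ, mul_comm]
  have h := WeightData.weight_mul_strongWeight_le hD hm hG (k := k) (X := Y) (Y := X \ Y)
    disjoint_sdiff φ
  rwa [Finset.union_sdiff_of_subset hYX] at h

end Literature.MathematicalPhysics.StatisticalMechanics.GradientRG

end
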